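import Summits.BirchSwinnertonDyer.BirchSwinnertonDyer.Theorems.EisensteinPrimesBSDpOnCellCReorientedComposition
import Summits.BirchSwinnertonDyer.BirchSwinnertonDyer.Theorems.EisensteinPrimesBSDpOnCellCSplitPartner
import Summits.BirchSwinnertonDyer.Rank1Residual.Partition.EisensteinKernelTypeMultiplicative
import HarnessLib


/-!
# Crux 4 `BSDpOnCellC` (stmt-BirchSwinnertonDyer-19034), line b1 v9: the ψ-EVEN DOORS in the re-oriented
# currency — `BSD(E,p)` on `CellC ∩ {¬ GVPar}` from the 16 published facts + [cas-split] + the re-oriented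
# IMC atom c3′ ALONE (Keller–Yin Thm. D BY NAME), with NO main-conjecture input for the partner and, at
# `p ≥ 5`, NO value atom (cell `bsd-eis`, seat `bsd-eis-cgshw` g13; part 2 of 3 — part 1 = `…SplitPartner.lean`, part 3 = `…NotGVDoorsOfThmD.lean`)

HONEST FRAMING (cell `bsd-eis`, run/shared/lean/pub/bsd-eis/): theorems only; nothing booked; X2 stays
CONSTRUCTION-SHAPED; no label or count moves; BSD is not proved by any of this. Every theorem is
CONDITIONAL on its displayed binders — the sixteen published named facts and [cas-split] (fact-grade), the
re-oriented IMC atom c3♭′ / c3s♭′ (`X2.NonsplitIMCEqOnTreeIntOther` / `X2.SplitIMCEqOnTreeIntOther`,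
Keller–Yin 2024 Thm. D = Thm. 5.1.3, an UNREFEREED PREPRINT gapped at L1754, taken BY NAME where stated),
and at `p = 3` the value atom c2♭ / c2s♭ (NOT in print; two memo-level derivations on file, RULING L11 (G6)).

## What this file adds to the v9 kernel map (cgshw MEMO-16 §3, p488190–p489431)

In crux 4's composition `Reoriented.bsdpOnCellC_of_stubs_reoriented` (p488773) crux 3 `MazurMCOnCellB`
enters at ONE place: the rank-zero `p`-part of the CGLS partner `E^{(d_K)}` when that twist is ψ-odd
(`¬ GVPar`). The twist by the odd, `p`-unramified character `χ_{d_K}` FLIPS the Greenberg–Vatsal parity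
(`X2.pPartRankZero_twist_of_not_gvPar`, on x1a's `gvPar_of_not_gvPar_of_twist`), so for a ψ-EVEN
rank-one pair (`¬ GVPar W p`; census sub-rows `CellCNonsplitNotGV` 2 552 @3 · 93 @5 · 17 @7 and
`CellCSplitNotGV` 7 429 @3 · 280 @5 · 19 @7 of `X2/ClassClosureO9.lean`) the partner lies in the CLOSED
sub-cell X2a and crux 3 is not needed. The tree had this door only in the OLD orientation (k5-c4's
`X2.bsdp_of_cellCNonsplitNotGV_of_pNewValue_of_imcInt`, cgshw g9's
`X2.bsdp_of_cellCSplitNotGV_of_pNewValue_of_imcInt_of_ctlOrSwitch`, family A, NOT fed by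
`KellerYin2024.thmD_…_OPEN` — littype-05 (C4) verdict, RULING L33), and the re-oriented PRE-tier theorem
`Reoriented.bsdpOnCellC_of_thmD_OPEN` (p489431) carries `stub_c2` and crux 3 for ALL of cell C. Here:

* §1 (part 1, `…SplitPartner.lean`) `bsdp_of_cellC_of_split_of_manin_of_pNewValue_of_imcIntOther_of_partner`,
  `bsdp_of_cellC_of_split_of_manin_of_intResidualsOther_of_partner` — the SPLIT partner-supply twins of
  p488442 / p488440 (there the partner is taken by parity cases with Mazur's MC on X2b ∩ {split}; in part 1
  from a supply `hpartner`, exactly as the non-split `…_of_partner` theorems of those files do).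
* §2 `bsdp_of_cellC_of_not_gvPar_of_manin_of_pNewValue_of_imcIntOther` (`p ≥ 5`, both signs, value FROM
  PRINT) and `bsdp_of_cellC_of_not_gvPar_of_manin_of_intResidualsOther` (any odd `p`, value atom typed) —
  pointwise with a Manin datum, the partner SUPPLIED by `X2.pPartRankZero_twist_of_not_gvPar`.
* §3 class level: `bsdpOnCellCNotGV_of_imcIntOther` — `∀ W p, CellC W p → ¬ GVPar W p → BSDp W p` from the
  16 published facts + [cas-split] (= v9's `stub_publishedFacts` VERBATIM), the re-oriented IMC atom at
  every CellC pair of the sign (= v9's `stub_c3` VERBATIM) and the value atom at `p = 3` (= v9's `stub_c2`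
  VERBATIM); the Manin condition is moved to the `X₀(N)`-optimal curve (`X2.bsdp_of_cellC_of_forall_isIsogenous`)
  and the parity travels along the isogeny by the TATE-FREE
  `KernelDisc.gvPar_iff_of_isIsogenous_of_hasMultiplicativeReduction` (lit-cgls s15; Serre §1.12 inertia
  line, no Silverman V.5.3/5.4 binder); and `bsdpOnCellCNotGV_of_imcIntOther_of_five_le` — the same at
  `p ≥ 5` with NO value atom.
* §4 (part 3, `…NotGVDoorsOfThmD.lean`) BY NAME at the PRE tier: `bsdpOnCellCNotGV_of_thmD_OPEN_of_five_le` —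
  `∀ W p, 5 ≤ p → CellC W p → ¬ GVPar W p → BSDp W p` from `stub_publishedFacts` and
  `KellerYin2024.thmD_…_OPEN` ONLY (the 409 ψ-even B11 cells at `p ∈ {5, 7}`), and
  `bsdpOnCellCNotGV_of_thmD_OPEN` (all odd `p`, modulo `stub_c2` at `p = 3`: the 9 981 ψ-even cells @3).

References: [Castella2018Exceptional] Thms. 2.10–2.11; [Castella2018] Thm. 2.3, §5; [Hsieh2014] Thm. 1;
[GreenbergVatsal2000] Thm. (1.3), §2 p. 28; [KellerYin2024] Thm. D = Thm. 5.1.3 (PRE); [CastellaEtAl2021]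
Thm. 5.3.1; [Mazur1978] Cor. 4.1; [MilneADT2006] I.7.3; [SerreInventiones1972] §1.12; [Miller2011LMS]
Def. 1.1; RULINGS L11 / L31 / L32 / L33 / L34; cell memos cgshw MEMO-16, c3h MEMO-2/3.
-/

set_option autoImplicit false
set_option linter.dupNamespace false

noncomputable section

open scoped Classical MatrixGroups ModularForm Topology

open Filter CongruenceSubgroup WeierstrassCurve NumberField IsDedekindDomain Field PowerSeries
  Literature.NumberTheory.EllipticCurves Literature.NumberTheory.EllipticCurves.GreenbergSelmer
  Literature.NumberTheory.EllipticCurves.ModularForms Literature.NumberTheory.QuadraticFields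
  Literature.NumberTheory.EllipticCurves.Rank1Residual
  Literature.NumberTheory.EllipticCurves.Rank1Residual.Typed
  Literature.NumberTheory.EllipticCurves.KrizLi2019
  Literature.NumberTheory.EllipticCurves.GreenbergVatsal2000
  Literature.NumberTheory.EllipticCurves.Wuthrich2014
  Literature.NumberTheory.EllipticCurves.SteinWuthrich2013
  Literature.NumberTheory.EllipticCurves.Castella2018
  Literature.NumberTheory.EllipticCurves.Castella2018Exceptional
  Literature.NumberTheory.GaloisRepresentations Literature.NumberTheory.GaloisCohomology
  Literature.NumberTheory.Automorphic
  Summit.BirchSwinnertonDyer.Rank1Residual.X11b.AcSelmer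
  Summit.BirchSwinnertonDyer.Rank1Residual.X11b.Halves
  Summit.BirchSwinnertonDyer.Rank1Residual.X11b
  Summit.BirchSwinnertonDyer.Rank1Residual.X2
  Summit.BirchSwinnertonDyer.Rank1Residual

namespace Summit.BirchSwinnertonDyer.BirchSwinnertonDyer.Theorems.Reoriented

/-! ### §2 Pointwise on the ψ-even sub-cells: the partner SUPPLIED by the closed sub-cell X2a -/

section NotGVPointwise

variable (W : WeierstrassCurve ℚ) [W.IsElliptic] [W.IsGloballyMinimal] (p : ℕ) [Fact p.Prime]

/-- **X2c ∩ {¬ GVPar}, `p ≥ 5`, BOTH signs, pointwise with a Manin datum — value FROM PRINT, IMC atom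
RE-ORIENTED, NO main-conjecture input.** For a rank-one X2 pair `(E, p)`, `p ≥ 5`, with `¬ GVPar W p`
(ψ even) and a newform datum with `p ∤ c`: `BSD(E,p)` from the PUBLISHED named facts (the Greenberg–Vatsal
package `hGV hWu hJs hJn hHs hHn hpar hGS` serves the partner ONLY), [cas-split] `hCS`, Hsieh `hH`, and the
re-oriented IMC atom of the pair's sign (`h3n` / `h3s`). The CGLS partner `E^{(d_K)}` is ψ-ODD
(`X2.pPartRankZero_twist_of_not_gvPar`: the twist by the odd, `p`-unramified `χ_{d_K}` flips the parity —
Greenberg–Vatsal 2000 + Kato on the CLOSED sub-cell X2a), so crux 3 does not enter. Sign split: §1 /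
p488442's non-split `…_of_partner`. CONDITIONAL on every listed binder; nothing booked.
[cite: GreenbergVatsal2000, Thm. (1.3) and §2 p. 28] [cite: Castella2018Exceptional, Thm. 2.10 and Thm. 2.11 (arXiv:1507.04260 pp. 13–14)]
[cite: Hsieh2014, Thm. 1 (arXiv:1112.1580 pp. 3–4)] [claim: KellerYin2024, status: under-review]
[cite: CastellaEtAl2021, Thm. 5.3.1 (last paragraph of the proof)] [cite: Miller2011LMS, Def. 1.1] -/
theorem bsdp_of_cellC_of_not_gvPar_of_manin_of_pNewValue_of_imcIntOther
    (hGV : lambdaMu_multiplicative_of_gvPar) (hWu : thm16_charIdeal_dvd_multiplicative_of_reducible)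
    (hJs : thm61_splitMultiplicative) (hJn : thm61_nonsplitMultiplicative)
    (hHs : exists_isSplitMultCanonical) (hHn : exists_isMultCanonical)
    (hpar : nonempty_modularParametrizationData)
    (hGS : ∀ (W : WeierstrassCurve ℚ) [W.IsElliptic] [W.IsGloballyMinimal] (p : ℕ) [Fact p.Prime],
      greenberg_stevens (W := W) (p := p))
    (hnf : exists_isNewformOf)
    (hPT : ∀ (K : Type) [Field K] [NumberField K], poitouTate_selmerStructure_duality K)
    (hPT2 : ∀ (K : Type) [Field K] [NumberField K], poitouTate_sha_tateDual K)
    (hEP : ∀ (K : Type) [Field K] [NumberField K] (v : HeightOneSpectrum (𝓞 K)),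
      localEulerPoincareCharacteristic (v.adicCompletion K))
    (hcd : fieldCdLE_two_of_numberField)
    (hBr : ∀ (K : Type) [Field K] [NumberField K] (p : ℕ) [Fact p.Prime],
      ZpExtension.decomp_not_le_kerSubgroup_of_isAnticyclotomic K p)
    (hH : hsieh2014_exists_anticyclotomicPAdicLFunction)
    (hCS : thm210_thm211_bdpDisplay_pNew)
    (hGZ : ∀ (N : ℕ) [NeZero N] (W : WeierstrassCurve ℚ) (K : Type) [Field K] [NumberField K],
      gross_zagier N W K)
    (hKo : ∀ (N : ℕ) [NeZero N] (W : WeierstrassCurve ℚ) (K : Type) [Field K] [NumberField K],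
      kolyvagin N W K)
    (hHP : ∀ (N : ℕ) [NeZero N] (W : WeierstrassCurve ℚ) (K : Type) [Field K] [NumberField K],
      heegnerPointComplex_mem_range_map N W K)
    (hGZK : rank_eq_analyticRank_of_analyticRank_le_one)
    (hHL : HoffsteinLuo1997_exists_twist_L_one_ne_zero)
    (hp5 : 5 ≤ p) (hc : CellC W p) (hnot : ¬ GVPar W p) (hMan : HasPrimeToManinDatum W p)
    (h3n : ¬ W.HasSplitMultiplicativeReductionAtPrime p → NonsplitIMCEqOnTreeIntOther W p)
    (h3s : W.HasSplitMultiplicativeReductionAtPrime p → SplitIMCEqOnTreeIntOther W p) :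
    BSDp W p := by
  have hmod : hasEntireLFunction_rat := WeierstrassCurve.hasEntireLFunction_rat_of_exists_isNewformOf hnf
  by_cases hs : W.HasSplitMultiplicativeReductionAtPrime p
  · exact bsdp_of_cellC_of_split_of_manin_of_pNewValue_of_imcIntOther_of_partner W p hnf hPT hPT2 hEP
      hBr hH hCS hGZ hKo hHP hGZK hHL hp5 hc hs hMan (h3s hs)
      (fun K _ _ hK _ _ _ hHp _ Wd _ _ hWd hrd ↦
        pPartRankZero_twist_of_not_gvPar hGV hWu hJs hJn hHs hHn hGZK hmod hpar hGS W p hc.2 hnot K hK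
          hHp Wd hWd hrd)
  · exact bsdp_of_cellC_of_not_split_of_manin_of_pNewValue_of_imcIntOther_of_partner W p hnf hPT hPT2
      hEP hcd hBr hH hCS hGZ hKo hHP hGZK hHL hp5 hc hs hMan (h3n hs)
      (fun K _ _ hK _ _ _ hHp _ Wd _ _ hWd hrd ↦
        pPartRankZero_twist_of_not_gvPar hGV hWu hJs hJn hHs hHn hGZK hmod hpar hGS W p hc.2 hnot K hK
          hHp Wd hWd hrd)

/-- **X2c ∩ {¬ GVPar}, any odd `p`, BOTH signs, pointwise with a Manin datum — value atom TYPED (`h2n` /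
`h2s`, the c2♭ / c2s♭ of the sign), IMC atom RE-ORIENTED, NO main-conjecture input.** As the previous
theorem in the regime where the value at `𝟙` is not in print (`p = 3`): sign split over §1's
`…split…intResidualsOther_of_partner` / p488440's non-split `…_of_partner`, the partner from
`X2.pPartRankZero_twist_of_not_gvPar`. CONDITIONAL on every listed binder; nothing booked.
[cite: GreenbergVatsal2000, Thm. (1.3) and §2 p. 28] [cite: Hsieh2014, Thm. 1 (arXiv:1112.1580 pp. 3–4)]
[claim: KellerYin2024, status: under-review] [cite: CastellaEtAl2021, Thm. 5.3.1 (last paragraph of the proof)]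
[cite: Miller2011LMS, Def. 1.1] -/
theorem bsdp_of_cellC_of_not_gvPar_of_manin_of_intResidualsOther
    (hGV : lambdaMu_multiplicative_of_gvPar) (hWu : thm16_charIdeal_dvd_multiplicative_of_reducible)
    (hJs : thm61_splitMultiplicative) (hJn : thm61_nonsplitMultiplicative)
    (hHs : exists_isSplitMultCanonical) (hHn : exists_isMultCanonical)
    (hpar : nonempty_modularParametrizationData)
    (hGS : ∀ (W : WeierstrassCurve ℚ) [W.IsElliptic] [W.IsGloballyMinimal] (p : ℕ) [Fact p.Prime],
      greenberg_stevens (W := W) (p := p))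
    (hnf : exists_isNewformOf)
    (hPT : ∀ (K : Type) [Field K] [NumberField K], poitouTate_selmerStructure_duality K)
    (hPT2 : ∀ (K : Type) [Field K] [NumberField K], poitouTate_sha_tateDual K)
    (hEP : ∀ (K : Type) [Field K] [NumberField K] (v : HeightOneSpectrum (𝓞 K)),
      localEulerPoincareCharacteristic (v.adicCompletion K))
    (hcd : fieldCdLE_two_of_numberField)
    (hBr : ∀ (K : Type) [Field K] [NumberField K] (p : ℕ) [Fact p.Prime],
      ZpExtension.decomp_not_le_kerSubgroup_of_isAnticyclotomic K p)
    (hH : hsieh2014_exists_anticyclotomicPAdicLFunction)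
    (hGZ : ∀ (N : ℕ) [NeZero N] (W : WeierstrassCurve ℚ) (K : Type) [Field K] [NumberField K],
      gross_zagier N W K)
    (hKo : ∀ (N : ℕ) [NeZero N] (W : WeierstrassCurve ℚ) (K : Type) [Field K] [NumberField K],
      kolyvagin N W K)
    (hHP : ∀ (N : ℕ) [NeZero N] (W : WeierstrassCurve ℚ) (K : Type) [Field K] [NumberField K],
      heegnerPointComplex_mem_range_map N W K)
    (hGZK : rank_eq_analyticRank_of_analyticRank_le_one)
    (hHL : HoffsteinLuo1997_exists_twist_L_one_ne_zero)
    (hc : CellC W p) (hnot : ¬ GVPar W p) (hMan : HasPrimeToManinDatum W p)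
    (h2n : ¬ W.HasSplitMultiplicativeReductionAtPrime p → NonsplitBDPValueOnTreeInt W p)
    (h2s : W.HasSplitMultiplicativeReductionAtPrime p → SplitBDPValueOnTreeInt W p)
    (h3n : ¬ W.HasSplitMultiplicativeReductionAtPrime p → NonsplitIMCEqOnTreeIntOther W p)
    (h3s : W.HasSplitMultiplicativeReductionAtPrime p → SplitIMCEqOnTreeIntOther W p) :
    BSDp W p := by
  have hmod : hasEntireLFunction_rat := WeierstrassCurve.hasEntireLFunction_rat_of_exists_isNewformOf hnf
  by_cases hs : W.HasSplitMultiplicativeReductionAtPrime p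
  · exact bsdp_of_cellC_of_split_of_manin_of_intResidualsOther_of_partner W p hnf hPT hPT2 hEP hBr hH
      hGZ hKo hHP hGZK hHL hc hs hMan (h2s hs) (h3s hs)
      (fun K _ _ hK _ _ _ hHp _ Wd _ _ hWd hrd ↦
        pPartRankZero_twist_of_not_gvPar hGV hWu hJs hJn hHs hHn hGZK hmod hpar hGS W p hc.2 hnot K hK
          hHp Wd hWd hrd)
  · exact bsdp_of_cellC_of_not_split_of_manin_of_intResidualsOther_of_partner W p hnf hPT hPT2 hEP hcd
      hBr hH hGZ hKo hHP hGZK hHL hc hs hMan (h2n hs) (h3n hs)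
      (fun K _ _ hK _ _ _ hHp _ Wd _ _ hWd hrd ↦
        pPartRankZero_twist_of_not_gvPar hGV hWu hJs hJn hHs hHn hGZK hmod hpar hGS W p hc.2 hnot K hK
          hHp Wd hWd hrd)

end NotGVPointwise

/-! ### §3 Class level on `CellC ∩ {¬ GVPar}`: the v9 stub conjunctions VERBATIM, minus crux 3 -/

section NotGVClass

/-- **`CellC ∩ {¬ GVPar}` ⇒ `BSD(E,p)`, CLASS LEVEL, from v9's `stub_publishedFacts`, `stub_c2` (used at
`p = 3` only) and the re-oriented `stub_c3` VERBATIM — NO crux 3.** Proof: the eight PROVED published inputs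
by name (as in `bsdpOnCellC_of_stubs_reoriented`); the Manin condition moved to the `X₀(N)`-optimal curve of
the class (`X2.bsdp_of_cellC_of_forall_isIsogenous`: Mazur 1978 Cor. 4.1, Edixhoven, Cassels), along which
`¬ GVPar` travels by the TATE-FREE `KernelDisc.gvPar_iff_of_isIsogenous_of_hasMultiplicativeReduction`
(Serre 1972 §1.12 inertia line; no Silverman V.5.3/5.4 binder); then `5 ≤ p` / `p = 3` (the only odd prime
below `5`) and §2. CONDITIONAL on every listed binder; nothing booked; X2 CONSTRUCTION-SHAPED; no label change.
[cite: GreenbergVatsal2000, Thm. (1.3) and §2 p. 28] [cite: SerreInventiones1972, §1.12]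
[cite: Castella2018Exceptional, Thm. 2.10 and Thm. 2.11 (arXiv:1507.04260 pp. 13–14)]
[cite: Hsieh2014, Thm. 1 (arXiv:1112.1580 pp. 3–4)] [claim: KellerYin2024, status: under-review]
[cite: CastellaEtAl2021, Thm. 5.3.1] [cite: Mazur1978, Cor. 4.1] [cite: MilneADT2006, Thm. I.7.3]
[cite: Miller2011LMS, Def. 1.1] -/
theorem bsdpOnCellCNotGV_of_imcIntOther
    (hPub : (lambdaMu_multiplicative_of_gvPar ∧ thm16_charIdeal_dvd_multiplicative_of_reducible ∧
      thm61_splitMultiplicative ∧ thm61_nonsplitMultiplicative ∧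
      (∀ (W : WeierstrassCurve ℚ) [W.IsElliptic] [W.IsGloballyMinimal] (p : ℕ) [Fact p.Prime],
        greenberg_stevens (W := W) (p := p)) ∧
      exists_isNewformOf ∧
      (∀ (K : Type) [Field K] [NumberField K], poitouTate_selmerStructure_duality K) ∧
      (∀ (K : Type) [Field K] [NumberField K], poitouTate_sha_tateDual K) ∧
      hsieh2014_exists_anticyclotomicPAdicLFunction ∧
      (∀ (N : ℕ) [NeZero N] (W : WeierstrassCurve ℚ) (K : Type) [Field K] [NumberField K],
        gross_zagier N W K) ∧
      (∀ (N : ℕ) [NeZero N] (W : WeierstrassCurve ℚ) (K : Type) [Field K] [NumberField K],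
        kolyvagin N W K) ∧
      rank_eq_analyticRank_of_analyticRank_le_one ∧ HoffsteinLuo1997_exists_twist_L_one_ne_zero ∧
      mazur_not_dvd_maninConstant_of_odd ∧ bsdRHS_eq_of_isIsogenous) ∧
      thm210_thm211_bdpDisplay_pNew)
    (h2 : (∀ (W : WeierstrassCurve ℚ) [W.IsElliptic] [W.IsGloballyMinimal] (p : ℕ) [Fact p.Prime],
        p = 3 → CellC W p → ¬ W.HasSplitMultiplicativeReductionAtPrime p → NonsplitBDPValueOnTreeInt W p) ∧
      (∀ (W : WeierstrassCurve ℚ) [W.IsElliptic] [W.IsGloballyMinimal] (p : ℕ) [Fact p.Prime],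
        p = 3 → CellC W p → W.HasSplitMultiplicativeReductionAtPrime p → SplitBDPValueOnTreeInt W p))
    (h3 : (∀ (W : WeierstrassCurve ℚ) [W.IsElliptic] [W.IsGloballyMinimal] (p : ℕ) [Fact p.Prime],
        CellC W p → ¬ W.HasSplitMultiplicativeReductionAtPrime p → NonsplitIMCEqOnTreeIntOther W p) ∧
      (∀ (W : WeierstrassCurve ℚ) [W.IsElliptic] [W.IsGloballyMinimal] (p : ℕ) [Fact p.Prime],
        CellC W p → W.HasSplitMultiplicativeReductionAtPrime p → SplitIMCEqOnTreeIntOther W p)) :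
    ∀ (W : WeierstrassCurve ℚ) [W.IsElliptic] [W.IsGloballyMinimal] (p : ℕ) [Fact p.Prime],
      CellC W p → ¬ GVPar W p → BSDp W p := by
  obtain ⟨⟨hGV, hWu, hJs, hJn, hGS, hnf, hPT, hPT2, hH, hGZ, hKo, hGZK, hHL, hMaz, hCassels⟩, hCS⟩ :=
    hPub
  obtain ⟨h2three, h2sthree⟩ := h2
  obtain ⟨h3n, h3s⟩ := h3
  -- the eight PROVED published inputs, by name
  have hHs : exists_isSplitMultCanonical := SteinWuthrich2013.exists_isSplitMultCanonical_holds
  have hHn : exists_isMultCanonical := SteinWuthrich2013.exists_isMultCanonical_holds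
  have hpar : nonempty_modularParametrizationData :=
    nonempty_modularParametrizationData_iff_exists_isNewformOf_unconditional.mpr hnf
  have hEP : ∀ (K : Type) [Field K] [NumberField K] (v : HeightOneSpectrum (𝓞 K)),
      localEulerPoincareCharacteristic (v.adicCompletion K) :=
    fun K _ _ v ↦ X11b.LocBridge.localEulerPoincareCharacteristic_adicCompletionEP K v
  have hcd : fieldCdLE_two_of_numberField :=
    Literature.NumberTheory.GaloisRepresentations.fieldCdLE_two_of_numberField_holds
  have hBr : ∀ (K : Type) [Field K] [NumberField K] (p : ℕ) [Fact p.Prime],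
      ZpExtension.decomp_not_le_kerSubgroup_of_isAnticyclotomic K p :=
    fun K _ _ p _ ↦ ZpExtension.decomp_not_le_kerSubgroup_of_isAnticyclotomic_holds (K := K) (p := p)
  have hHP : ∀ (N : ℕ) [NeZero N] (W : WeierstrassCurve ℚ) (K : Type) [Field K] [NumberField K],
      heegnerPointComplex_mem_range_map N W K :=
    fun N _ W K _ _ ↦ heegnerPointComplex_mem_range_map_holds N W K
  have hEd : edixhoven_optimalManinConstant_integral :=
    ModularForms.edixhoven_optimalManinConstant_integral_holds
  intro W _ _ p _ hc hnot
  have hp : p.Prime := Fact.out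
  -- `p` is an odd prime: either `5 ≤ p` or `p = 3`
  have hp35 : 5 ≤ p ∨ p = 3 := by
    by_cases hp5 : 5 ≤ p
    · exact Or.inl hp5
    · right
      have hp2 : p ≠ 2 := hc.2.1
      have h2le := hp.two_le
      interval_cases p
      · exact absurd rfl hp2
      · rfl
      · exact absurd hp (by decide)
  -- the Manin condition moved to the optimal curve; `¬ GVPar` travels along the isogeny (Tate-free)
  refine bsdp_of_cellC_of_forall_isIsogenous hEd hMaz hCassels hpar hnf hGZK W p hc ?_
  intro W₀ _ _ hiso hc₀ hMan₀
  have hnot₀ : ¬ GVPar W₀ p := fun h ↦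
    hnot ((KernelDisc.gvPar_iff_of_isIsogenous_of_hasMultiplicativeReduction hc.2.1 hc.2.2.2 hiso).mpr h)
  rcases hp35 with hp5 | hp3
  · exact bsdp_of_cellC_of_not_gvPar_of_manin_of_pNewValue_of_imcIntOther W₀ p hGV hWu hJs hJn hHs hHn
      hpar hGS hnf hPT hPT2 hEP hcd hBr hH hCS hGZ hKo hHP hGZK hHL hp5 hc₀ hnot₀ hMan₀
      (fun hns ↦ h3n W₀ p hc₀ hns) (fun hs ↦ h3s W₀ p hc₀ hs)
  · exact bsdp_of_cellC_of_not_gvPar_of_manin_of_intResidualsOther W₀ p hGV hWu hJs hJn hHs hHn hpar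
      hGS hnf hPT hPT2 hEP hcd hBr hH hGZ hKo hHP hGZK hHL hc₀ hnot₀ hMan₀
      (fun hns ↦ h2three W₀ p hp3 hc₀ hns) (fun hs ↦ h2sthree W₀ p hp3 hc₀ hs)
      (fun hns ↦ h3n W₀ p hc₀ hns) (fun hs ↦ h3s W₀ p hc₀ hs)

/-- **`CellC ∩ {¬ GVPar}` at `p ≥ 5` ⇒ `BSD(E,p)`, CLASS LEVEL, from v9's `stub_publishedFacts` and the
re-oriented `stub_c3` VERBATIM — NO value atom, NO crux 3.** As the previous theorem with only the `5 ≤ p`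
branch (value half FROM PRINT, [cas-split]); the `stub_c2` slot is never reached. CONDITIONAL on every listed
binder; nothing booked; X2 CONSTRUCTION-SHAPED; no label change.
[cite: GreenbergVatsal2000, Thm. (1.3) and §2 p. 28] [cite: SerreInventiones1972, §1.12]
[cite: Castella2018Exceptional, Thm. 2.10 and Thm. 2.11 (arXiv:1507.04260 pp. 13–14)]
[cite: Hsieh2014, Thm. 1 (arXiv:1112.1580 pp. 3–4)] [claim: KellerYin2024, status: under-review]
[cite: CastellaEtAl2021, Thm. 5.3.1] [cite: Mazur1978, Cor. 4.1] [cite: Miller2011LMS, Def. 1.1] -/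
theorem bsdpOnCellCNotGV_of_imcIntOther_of_five_le
    (hPub : (lambdaMu_multiplicative_of_gvPar ∧ thm16_charIdeal_dvd_multiplicative_of_reducible ∧
      thm61_splitMultiplicative ∧ thm61_nonsplitMultiplicative ∧
      (∀ (W : WeierstrassCurve ℚ) [W.IsElliptic] [W.IsGloballyMinimal] (p : ℕ) [Fact p.Prime],
        greenberg_stevens (W := W) (p := p)) ∧
      exists_isNewformOf ∧
      (∀ (K : Type) [Field K] [NumberField K], poitouTate_selmerStructure_duality K) ∧
      (∀ (K : Type) [Field K] [NumberField K], poitouTate_sha_tateDual K) ∧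
      hsieh2014_exists_anticyclotomicPAdicLFunction ∧
      (∀ (N : ℕ) [NeZero N] (W : WeierstrassCurve ℚ) (K : Type) [Field K] [NumberField K],
        gross_zagier N W K) ∧
      (∀ (N : ℕ) [NeZero N] (W : WeierstrassCurve ℚ) (K : Type) [Field K] [NumberField K],
        kolyvagin N W K) ∧
      rank_eq_analyticRank_of_analyticRank_le_one ∧ HoffsteinLuo1997_exists_twist_L_one_ne_zero ∧
      mazur_not_dvd_maninConstant_of_odd ∧ bsdRHS_eq_of_isIsogenous) ∧
      thm210_thm211_bdpDisplay_pNew)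
    (h3 : (∀ (W : WeierstrassCurve ℚ) [W.IsElliptic] [W.IsGloballyMinimal] (p : ℕ) [Fact p.Prime],
        CellC W p → ¬ W.HasSplitMultiplicativeReductionAtPrime p → NonsplitIMCEqOnTreeIntOther W p) ∧
      (∀ (W : WeierstrassCurve ℚ) [W.IsElliptic] [W.IsGloballyMinimal] (p : ℕ) [Fact p.Prime],
        CellC W p → W.HasSplitMultiplicativeReductionAtPrime p → SplitIMCEqOnTreeIntOther W p)) :
    ∀ (W : WeierstrassCurve ℚ) [W.IsElliptic] [W.IsGloballyMinimal] (p : ℕ) [Fact p.Prime],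
      5 ≤ p → CellC W p → ¬ GVPar W p → BSDp W p := by
  obtain ⟨⟨hGV, hWu, hJs, hJn, hGS, hnf, hPT, hPT2, hH, hGZ, hKo, hGZK, hHL, hMaz, hCassels⟩, hCS⟩ :=
    hPub
  obtain ⟨h3n, h3s⟩ := h3
  have hHs : exists_isSplitMultCanonical := SteinWuthrich2013.exists_isSplitMultCanonical_holds
  have hHn : exists_isMultCanonical := SteinWuthrich2013.exists_isMultCanonical_holds
  have hpar : nonempty_modularParametrizationData :=
    nonempty_modularParametrizationData_iff_exists_isNewformOf_unconditional.mpr hnf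
  have hEP : ∀ (K : Type) [Field K] [NumberField K] (v : HeightOneSpectrum (𝓞 K)),
      localEulerPoincareCharacteristic (v.adicCompletion K) :=
    fun K _ _ v ↦ X11b.LocBridge.localEulerPoincareCharacteristic_adicCompletionEP K v
  have hcd : fieldCdLE_two_of_numberField :=
    Literature.NumberTheory.GaloisRepresentations.fieldCdLE_two_of_numberField_holds
  have hBr : ∀ (K : Type) [Field K] [NumberField K] (p : ℕ) [Fact p.Prime],
      ZpExtension.decomp_not_le_kerSubgroup_of_isAnticyclotomic K p :=
    fun K _ _ p _ ↦ ZpExtension.decomp_not_le_kerSubgroup_of_isAnticyclotomic_holds (K := K) (p := p)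
  have hHP : ∀ (N : ℕ) [NeZero N] (W : WeierstrassCurve ℚ) (K : Type) [Field K] [NumberField K],
      heegnerPointComplex_mem_range_map N W K :=
    fun N _ W K _ _ ↦ heegnerPointComplex_mem_range_map_holds N W K
  have hEd : edixhoven_optimalManinConstant_integral :=
    ModularForms.edixhoven_optimalManinConstant_integral_holds
  intro W _ _ p _ hp5 hc hnot
  refine bsdp_of_cellC_of_forall_isIsogenous hEd hMaz hCassels hpar hnf hGZK W p hc ?_
  intro W₀ _ _ hiso hc₀ hMan₀
  have hnot₀ : ¬ GVPar W₀ p := fun h ↦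
    hnot ((KernelDisc.gvPar_iff_of_isIsogenous_of_hasMultiplicativeReduction hc.2.1 hc.2.2.2 hiso).mpr h)
  exact bsdp_of_cellC_of_not_gvPar_of_manin_of_pNewValue_of_imcIntOther W₀ p hGV hWu hJs hJn hHs hHn hpar
    hGS hnf hPT hPT2 hEP hcd hBr hH hCS hGZ hKo hHP hGZK hHL hp5 hc₀ hnot₀ hMan₀
    (fun hns ↦ h3n W₀ p hc₀ hns) (fun hs ↦ h3s W₀ p hc₀ hs)

end NotGVClass


end Summit.BirchSwinnertonDyer.BirchSwinnertonDyer.Theorems.Reoriented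

end
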